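import Mathlib.NumberTheory.Padics.HeightOneSpectrum
import Mathlib.Data.ZMod.QuotientRing
import Literature.NumberTheory.QuadraticForms.HilbertSymbolNonDyadic
import Literature.NumberTheory.QuadraticForms.HilbertSymbolRatSigns
import HarnessLib

/-!
# The Hilbert symbol of rational numbers at an odd prime (Serre III Thm. 1, `p ≠ 2`)

Topic `NumberTheory/QuadraticForms`; namespace `Literature` (and `Literature.RatPlace` for the dictionary
between finite places of `ℚ` and rational primes); all declarations are definitions with bodies
or fully proved theorems.

For a finite place `v` of `ℚ` (`v : HeightOneSpectrum (𝓞 ℚ)`) let `p = natGenerator v` be the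
rational prime under it (Mathlib `Rat.HeightOneSpectrum.natGenerator`). We record the dictionary
`v = (p)` (`asIdeal_eq_span_natGenerator`), `n ∈ v ↔ p ∣ n` (`intCast_mem_asIdeal_iff`), `v(p) = 1`
(`intValuation_natGenerator`), `𝓞 ℚ ⧸ v ≃+* ℤ ⧸ p` (`quotEquivZMod`) and "square mod `v` = square
mod `p`" (`isSquare_mk_intCast_iff`), and deduce from the non-dyadic rules of
`HilbertSymbolNonDyadic.lean` (`(u, w)_v = 1`, `(p u, w)_v = 1 ↔ w ≡ □`, `(p u, p w)_v = 1 ↔ -u w ≡ □`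
for `v`-units `u, w`) the **explicit value of the Hilbert symbol of two non-zero integers at an
odd prime** (Serre, *A Course in Arithmetic*, Ch. III §1.2 Thm. 1, case `p ≠ 2`):

  `hilbertSymbol_rat_eq_localSignOdd : (a, b)_v = localSignOdd p a b`
  `= (-1)^{α β ε(p)} (u / p)^β (w / p)^α` for `a = p^α u`, `b = p^β w`

(the right-hand side is the explicit sign of `HilbertSymbolRatSigns.lean`, whose product over all
places is `1` by `totalSign_eq_one`). This is step G2 of the proof of Hilbert reciprocity over `ℚ`;
the archimedean place is `HilbertSymbolRatArchimedean.lean` and the dyadic place remains.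

## References

* J.-P. Serre, *A Course in Arithmetic*, GTM 7, Springer (1973), Ch. III §1.2 Thm. 1 (PDF p. 20,
  proof p. 21: cases `α, β mod 2`).
-/

noncomputable section

open IsDedekindDomain NumberField WithZero Rat.HeightOneSpectrum ZMod

namespace Literature.NumberTheory.QuadraticForms

namespace RatPlace

variable (v : HeightOneSpectrum (𝓞 ℚ))

/-- The rational prime under a finite place `v` of `ℚ` (Mathlib `Rat.HeightOneSpectrum.natGenerator`)
is prime, as a `Fact` instance for `ZMod p`/`legendreSym p`. [folklore] -/
instance fact_prime_natGenerator : Fact (natGenerator v).Prime := ⟨prime_natGenerator v⟩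

/-- `v = (p)` in `𝓞 ℚ`: the prime ideal of a finite place of `ℚ` is generated by the rational
prime `p = natGenerator v` under it. [folklore] -/
theorem asIdeal_eq_span_natGenerator :
    v.asIdeal = Ideal.span {((natGenerator v : ℕ) : 𝓞 ℚ)} := by
  set e := Rat.IsIntegralClosure.intEquiv (𝓞 ℚ) with he
  have h1 : v.asIdeal = (Ideal.span {((natGenerator v : ℕ) : ℤ)}).comap e := by
    rw [span_natGenerator, Ideal.comap_map_of_bijective _ e.bijective]
  ext x
  rw [h1, Ideal.mem_comap, Ideal.mem_span_singleton, Ideal.mem_span_singleton,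
    ← map_dvd_iff e, map_natCast]

/-- An integer lies in `v` iff it is divisible by `p = natGenerator v`. [folklore] -/
theorem intCast_mem_asIdeal_iff (n : ℤ) :
    (n : 𝓞 ℚ) ∈ v.asIdeal ↔ ((natGenerator v : ℕ) : ℤ) ∣ n := by
  rw [asIdeal_eq_span_natGenerator, Ideal.mem_span_singleton]
  constructor
  · intro h
    have h' := map_dvd (Rat.ringOfIntegersEquiv : 𝓞 ℚ →+* ℤ) h
    simpa using h'
  · intro h
    have h' := map_dvd (Rat.ringOfIntegersEquiv.symm : ℤ →+* 𝓞 ℚ) h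
    simpa using h'

/-- The `v`-adic valuation of `p = natGenerator v` is `exp (-1)`: `p` is a uniformiser of `𝓞 ℚ`
at `v = (p)`. [folklore] -/
theorem intValuation_natGenerator :
    v.intValuation ((natGenerator v : ℕ) : 𝓞 ℚ) = exp (-1 : ℤ) := by
  have hp0 : ((natGenerator v : ℕ) : 𝓞 ℚ) ≠ 0 := by
    exact_mod_cast (prime_natGenerator v).ne_zero
  rw [HeightOneSpectrum.intValuation_eq_exp_neg_multiplicity v hp0, ← asIdeal_eq_span_natGenerator,
    multiplicity_self]
  rfl

/-- The residue field `𝓞 ℚ ⧸ v` is `ℤ ⧸ p`. [folklore] -/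
def quotEquivZMod : 𝓞 ℚ ⧸ v.asIdeal ≃+* ZMod (natGenerator v) :=
  (Ideal.quotEquivOfEq (asIdeal_eq_span_natGenerator v)).trans
    ((Ideal.quotientEquiv (Ideal.span {((natGenerator v : ℕ) : 𝓞 ℚ)})
      (Ideal.span {((natGenerator v : ℕ) : ℤ)}) Rat.ringOfIntegersEquiv
      (by rw [Ideal.map_span, Set.image_singleton]; simp)).trans
      (Int.quotientSpanNatEquivZMod (natGenerator v)))

/-- `quotEquivZMod` sends the class of an integer `n` to `n mod p`. [folklore] -/
theorem quotEquivZMod_mk_intCast (n : ℤ) :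
    quotEquivZMod v (Ideal.Quotient.mk v.asIdeal (n : 𝓞 ℚ)) = (n : ZMod (natGenerator v)) := by
  rw [map_intCast, map_intCast]

/-- Squares mod `v` are squares mod `p`. [folklore] -/
theorem isSquare_mk_intCast_iff (n : ℤ) :
    IsSquare (Ideal.Quotient.mk v.asIdeal (n : 𝓞 ℚ)) ↔ IsSquare ((n : ZMod (natGenerator v))) := by
  rw [← quotEquivZMod_mk_intCast]
  constructor
  · rintro ⟨r, hr⟩
    exact ⟨quotEquivZMod v r, by rw [hr, map_mul]⟩
  · rintro ⟨r, hr⟩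
    refine ⟨(quotEquivZMod v).symm r, (quotEquivZMod v).injective ?_⟩
    rw [map_mul, RingEquiv.apply_symm_apply, ← hr]

end RatPlace

/-! ### Sign bookkeeping -/

/-- A `±1`-valued integer raised to an even power is `1`. [folklore] -/
theorem pow_eq_one_of_even_of_sign {x : ℤ} (hx : x = 1 ∨ x = -1) {n : ℕ} (hn : Even n) :
    x ^ n = 1 := by
  rcases hx with rfl | rfl
  · exact one_pow n
  · exact hn.neg_one_pow

/-- A `±1`-valued integer raised to an odd power is itself. [folklore] -/
theorem pow_eq_self_of_odd_of_sign {x : ℤ} (hx : x = 1 ∨ x = -1) {n : ℕ} (hn : Odd n) :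
    x ^ n = x := by
  rcases hx with rfl | rfl
  · exact one_pow n
  · exact hn.neg_one_pow

/-- Two `±1`-valued integers that are `1` simultaneously are equal. [folklore] -/
theorem eq_of_sign_of_iff {x y : ℤ} (hx : x = 1 ∨ x = -1) (hy : y = 1 ∨ y = -1)
    (h : x = 1 ↔ y = 1) : x = y := by
  rcases hx with rfl | rfl <;> rcases hy with rfl | rfl
  · rfl
  · exact absurd (h.1 rfl) (by norm_num)
  · exact absurd (h.2 rfl) (by norm_num)
  · rfl

/-! ### The symbol of two integers at an odd prime -/

section OddPrime

variable (v : HeightOneSpectrum (𝓞 ℚ))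

open RatPlace

/-- Integers in `ℚ_v`: `algebraMap ℚ ℚ_v n = algebraMap (𝓞 ℚ) ℚ_v n`. [folklore] -/
theorem algebraMap_rat_intCast (n : ℤ) :
    algebraMap ℚ (v.adicCompletion ℚ) (n : ℚ) = algebraMap (𝓞 ℚ) (v.adicCompletion ℚ) (n : 𝓞 ℚ) := by
  rw [IsScalarTower.algebraMap_apply (𝓞 ℚ) ℚ (v.adicCompletion ℚ), map_intCast (algebraMap (𝓞 ℚ) ℚ)]

/-- An integer prime to `p = natGenerator v` is non-zero mod `p`. [folklore] -/
theorem intCast_zmod_natGenerator_ne_zero {n : ℤ} (h : ¬ ((natGenerator v : ℕ) : ℤ) ∣ n) :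
    (n : ZMod (natGenerator v)) ≠ 0 := by
  rwa [Ne, ZMod.intCast_zmod_eq_zero_iff_dvd]

/-- The uniformiser `p = natGenerator v` is non-zero in `ℚ_v`. [folklore] -/
theorem algebraMap_natGenerator_ne_zero :
    algebraMap (𝓞 ℚ) (v.adicCompletion ℚ) ((natGenerator v : ℕ) : 𝓞 ℚ) ≠ 0 := by
  have h := valued_algebraMap_uniformizer ℚ v (intValuation_natGenerator v)
  exact (Valuation.ne_zero_iff Valued.v).1 (h.trans_ne exp_ne_zero)

/-- **Square-class reduction**: in `ℚ_v`, a non-zero integer `n = p^α u` (`p = natGenerator v`,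
`p ∤ u`) is `p^{α mod 2} u` times a non-zero square. [folklore] -/
theorem exists_algebraMap_intCast_eq_mul_sq (n : ℤ) :
    ∃ c : v.adicCompletion ℚ, c ≠ 0 ∧
      algebraMap ℚ (v.adicCompletion ℚ) (n : ℚ) =
        algebraMap (𝓞 ℚ) (v.adicCompletion ℚ)
          (((natGenerator v : ℕ) : 𝓞 ℚ) ^ (padicValInt (natGenerator v) n % 2) *
            (primeCompl (natGenerator v) n : 𝓞 ℚ)) * c ^ 2 := by
  set p := natGenerator v with hp
  refine ⟨algebraMap (𝓞 ℚ) (v.adicCompletion ℚ) (((p : ℕ) : 𝓞 ℚ) ^ (padicValInt p n / 2)), ?_, ?_⟩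
  · rw [map_pow]
    exact pow_ne_zero _ (algebraMap_natGenerator_ne_zero v)
  · rw [algebraMap_rat_intCast, ← map_pow, ← map_mul]
    congr 1
    have hn : n = (p : ℤ) ^ padicValInt p n * primeCompl p n :=
      (pow_padicValInt_mul_primeCompl p n).symm
    conv_lhs => rw [hn, ← Nat.div_add_mod (padicValInt p n) 2]
    push_cast
    ring

/-- **The Hilbert symbol of rational integers at an odd prime is Serre's explicit sign**
(Serre, *A Course in Arithmetic*, Ch. III §1.2 Thm. 1, case `p ≠ 2`): for a finite place `v` of
`ℚ` over an odd prime `p` and non-zero integers `a = p^α u`, `b = p^β w`,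
`(a, b)_v = (-1)^{α β ε(p)} (u / p)^β (w / p)^α = localSignOdd p a b`. Proof: reduce `α, β`
modulo `2` (square classes, `exists_algebraMap_intCast_eq_mul_sq`); then `(u, w)_v = 1`
(`hilbertSymbol_eq_one_of_not_mem`), `(p u, w)_v = 1` iff `w` is a square mod `p` iff
`(w / p) = 1` (`hilbertSymbol_uniformizer_mul_iff`, `legendreSym.eq_one_iff`), and
`(p u, p w)_v = 1` iff `(-u w / p) = 1` (`hilbertSymbol_uniformizer_mul_uniformizer_mul_iff`),
while the explicit sign evaluates to `1`, `(w / p)`, `(-1 / p)(u / p)(w / p)` respectively.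
[cite: Serre1973, Ch. III §1.2 Thm. 1] -/
theorem hilbertSymbol_rat_eq_localSignOdd (hv2 : natGenerator v ≠ 2) {a b : ℤ} (ha : a ≠ 0)
    (hb : b ≠ 0) :
    hilbertSymbol (v.adicCompletion ℚ) (algebraMap ℚ _ (a : ℚ)) (algebraMap ℚ _ (b : ℚ)) =
      localSignOdd (natGenerator v) a b := by
  set p := natGenerator v with hp
  have hpp : p.Prime := prime_natGenerator v
  -- `2 ∉ v`
  have h2v : (2 : 𝓞 ℚ) ∉ v.asIdeal := by
    have h := intCast_mem_asIdeal_iff v 2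
    rw [Int.cast_ofNat] at h
    rw [h]
    intro hd
    exact hv2 ((Nat.prime_dvd_prime_iff_eq hpp Nat.prime_two).1 (by exact_mod_cast hd))
  -- decompositions `a = p^α u`, `b = p^β w`
  set α := padicValInt p a with hα
  set β := padicValInt p b with hβ
  set u := primeCompl p a with hu
  set w := primeCompl p b with hw
  have hpu : ¬ (p : ℤ) ∣ u := not_dvd_primeCompl ha
  have hpw : ¬ (p : ℤ) ∣ w := not_dvd_primeCompl hb
  have huv : (u : 𝓞 ℚ) ∉ v.asIdeal := by rw [intCast_mem_asIdeal_iff]; exact hpu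
  have hwv : (w : 𝓞 ℚ) ∉ v.asIdeal := by rw [intCast_mem_asIdeal_iff]; exact hpw
  have hu0 : (u : ZMod p) ≠ 0 := intCast_zmod_natGenerator_ne_zero v hpu
  have hw0 : (w : ZMod p) ≠ 0 := intCast_zmod_natGenerator_ne_zero v hpw
  have hlu : legendreSym p u = 1 ∨ legendreSym p u = -1 := legendreSym.eq_one_or_neg_one p hu0
  have hlw : legendreSym p w = 1 ∨ legendreSym p w = -1 := legendreSym.eq_one_or_neg_one p hw0
  have hχ : χ₄ (p : ZMod 4) = 1 ∨ χ₄ (p : ZMod 4) = -1 := by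
    have := χ₄_eq_one_or_of_odd (u := (p : ℤ)) (by
      rw [Int.odd_coe_nat]; exact hpp.odd_of_ne_two hv2)
    rwa [Int.cast_natCast] at this
  have hπ : v.intValuation ((p : ℕ) : 𝓞 ℚ) = exp (-1 : ℤ) := intValuation_natGenerator v
  haveI : v.asIdeal.IsMaximal := v.isMaximal
  haveI : Finite (𝓞 ℚ ⧸ v.asIdeal) := Ideal.finiteQuotientOfFreeOfNeBot _ v.ne_bot
  -- square-class reduction
  obtain ⟨c, hc0, hca⟩ := exists_algebraMap_intCast_eq_mul_sq v a
  obtain ⟨d, hd0, hdb⟩ := exists_algebraMap_intCast_eq_mul_sq v b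
  rw [hca, hdb, hilbertSymbol_mul_sq_left _ _ hc0, hilbertSymbol_mul_sq_right _ _ hd0,
    localSignOdd_def]
  simp only [← hp, ← hα, ← hβ, ← hu, ← hw]
  have hsymb := fun x y ↦ hilbertSymbol_eq_one_or_eq_neg_one (F := v.adicCompletion ℚ) x y
  -- parity cases
  rcases Nat.even_or_odd α with hαe | hαo <;> rcases Nat.even_or_odd β with hβe | hβo
  · -- `α, β` even: `(u, w)_v = 1`
    simp only [Nat.even_iff.1 hαe, Nat.even_iff.1 hβe, pow_zero, one_mul]
    refine (hilbertSymbol_eq_one_of_not_mem ℚ v h2v huv hwv).trans ?_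
    rw [pow_eq_one_of_even_of_sign hχ (hαe.mul_right _), pow_eq_one_of_even_of_sign hlu hβe,
      pow_eq_one_of_even_of_sign hlw hαe]
    norm_num
  · -- `α` even, `β` odd: `(u, p w)_v = (u / p)`
    simp only [Nat.even_iff.1 hαe, Nat.odd_iff.1 hβo, pow_zero, one_mul, pow_one]
    rw [pow_eq_one_of_even_of_sign hχ (hαe.mul_right _), pow_eq_self_of_odd_of_sign hlu hβo,
      pow_eq_one_of_even_of_sign hlw hαe, one_mul, mul_one, hilbertSymbol_comm]
    exact eq_of_sign_of_iff (hsymb _ _) hlu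
      ((hilbertSymbol_uniformizer_mul_iff ℚ v h2v hπ hwv huv).trans
        ((isSquare_mk_intCast_iff v u).trans (legendreSym.eq_one_iff p hu0).symm))
  · -- `α` odd, `β` even: `(p u, w)_v = (w / p)`
    simp only [Nat.odd_iff.1 hαo, Nat.even_iff.1 hβe, pow_zero, one_mul, pow_one]
    rw [pow_eq_one_of_even_of_sign hχ (hβe.mul_left _), pow_eq_one_of_even_of_sign hlu hβe,
      pow_eq_self_of_odd_of_sign hlw hαo, one_mul, one_mul]
    exact eq_of_sign_of_iff (hsymb _ _) hlw
      ((hilbertSymbol_uniformizer_mul_iff ℚ v h2v hπ huv hwv).trans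
        ((isSquare_mk_intCast_iff v w).trans (legendreSym.eq_one_iff p hw0).symm))
  · -- `α, β` odd: `(p u, p w)_v = (-u w / p)`
    simp only [Nat.odd_iff.1 hαo, Nat.odd_iff.1 hβo, pow_one]
    rw [pow_eq_self_of_odd_of_sign hχ (hαo.mul hβo), pow_eq_self_of_odd_of_sign hlu hβo,
      pow_eq_self_of_odd_of_sign hlw hαo]
    have huw0 : ((-(u * w) : ℤ) : ZMod p) ≠ 0 := by
      rw [Int.cast_neg, Int.cast_mul, neg_ne_zero]
      exact mul_ne_zero hu0 hw0
    have hl : χ₄ (p : ZMod 4) * legendreSym p u * legendreSym p w = legendreSym p (-(u * w)) := by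
      rw [neg_mul_eq_neg_mul, legendreSym.mul, legendreSym.at_neg hv2]
    rw [hl]
    have hsq : IsSquare (Ideal.Quotient.mk v.asIdeal (-((u : 𝓞 ℚ) * (w : 𝓞 ℚ)))) ↔
        IsSquare ((-(u * w) : ℤ) : ZMod p) := by
      have := isSquare_mk_intCast_iff v (-(u * w))
      rwa [Int.cast_neg, Int.cast_mul] at this
    exact eq_of_sign_of_iff (hsymb _ _) (legendreSym.eq_one_or_neg_one p huw0)
      ((hilbertSymbol_uniformizer_mul_uniformizer_mul_iff ℚ v h2v hπ huv hwv).trans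
        (hsq.trans (legendreSym.eq_one_iff p huw0).symm))

end OddPrime

end Literature.NumberTheory.QuadraticForms
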